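import Literature.AlgebraicGeometry.Modules.ModuleCechFiniteOfProper
import Literature.AlgebraicGeometry.Modules.CechFullToOrderedElementwise
import Literature.Algebra.Homology.OrderedCechSystemFullRing
import HarnessLib

/-!
# The cochain dictionaries between the sheaf Čech complexes over `X` and the algebraic Čech complexes of the
# system of sections (Görtz–Wedhorn II, Def. 21.64 / 21.68; The Stacks Project, Tags 01FG, 01FM)

Topic `AlgebraicGeometry/Modules`; namespace `Literature.AlgebraicGeometry.Modules`.  DEFINITION file (two explicit additive
bijections with their unfolding lemmas, then theorems); no named fact, no instance, no notation, no `sorry`.  Cell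
`hodgecm-mathlib` FLOOR 0, P1 sub-line F-11, packet (iv)∕J3 — HOWTO (a)+(b) of F0P1b-p01 (g0) for F0P1b-p02∕p04 (g0)
(F0P1b-plan (g0) RULINGS #3 (R14), 22:35:08Z).

For a scheme `X` (universe `0`, where the sheaf and the module Čech complexes meet, cf. ★ `Modules/ModuleCechFiniteOfProper`
§1), a finite linearly ordered family of opens `𝓤 = (U_i)_{i ∈ ι}`, an `𝒪_X`-module `M` and a ring map `ρ : A → Γ(X, 𝒪_X)`,
write `S := Modules.sectionsSystem 𝓤 M ρ : Finset ι ⥤ ModuleCat A` (`s ↦ Γ(M, U_s)`).  This file identifies, degreewise,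

* §1 **`Cech.sectionsToCochain 𝓤 M ρ n : Cech.Sections 𝓤 n M ⊤ ≃+ OrderedCech.Full.Cochain S n`** — the global sections of the
  FULL sheaf Čech complex ★ `Cech.complex 𝓤 M` (families `(c_α ∈ Γ(M, X ∩ U_α))_{α : [n] → ι}`) with the cochains of the full
  algebraic complex ★ `OrderedCech.Full.complex S` of `Algebra/Homology/OrderedCechSystemFull` (restriction along
  `X ∩ U_α = U_{ {α} }`), intertwining ★ `Cech.dSections` with the differential of `Full.complex S` (`sectionsToCochain_dSections`);
* §2 **`CechOrd.sectionsToSysCochain 𝓤 M ρ n : Cech.Sections (CechOrd.faces 𝓤 n) 0 M ⊤ ≃+ OrderedCech.SysCochain S n`** — the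
  explicit form of ★ `Modules.exists_cechSectionsAddEquiv` (ordered side), intertwining ★ `CechOrd.d` with ★ `OrderedCech.sysD`
  and `ρ(a) • _` with `a • _`;
* §3 `CechOrd.sectionsToSysCochain_resOfFullObj` — the two dictionaries carry the sheaf-level restriction ★ `CechOrd.resOfFullObj`
  to the algebraic restriction ★ `OrderedCech.Full.res`;
* §4 **`OrderedCech.Full.exists_d_eq_of_res_eq_sysD`** — HOWTO (b) in the algebraic currency: for a finite cover `𝓤` of `X` with
  affine finite intersections and `M` affine-localizing, a cocycle `c` of `Full.complex S` whose restriction `Full.res c` to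
  increasing tuples is an ordered coboundary `sysD g` is a coboundary of `Full.complex S` (★ `CechOrd.exists_dSections_eq_of_resOfFull_eq_d`
  transported through §1–§3).

## References
* U. Görtz, T. Wedhorn, *Algebraic Geometry II* (2023), Def. 21.64 (p. 179), Def. 21.68 (p. 180), Thm. 22.9 (p. 236). [GortzWedhorn2023]
* The Stacks Project, Tags 01FG, 01FM, 01XD. [StacksProject]
-/

noncomputable section

open CategoryTheory CategoryTheory.Abelian CategoryTheory.Limits Opposite TopologicalSpace AlgebraicGeometry
open Literature.Algebra.Homology

set_option backward.isDefEq.respectTransparency false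

namespace Literature.AlgebraicGeometry.Modules

variable {X : Scheme.{0}} {ι : Type} [LinearOrder ι] (U : ι → X.Opens) (M : X.Modules)
  {A : Type} [CommRing A] (ρ : A →+* Γ(X, ⊤))

/-! ## §0 Plumbing: faces versus `cechOpen`, `SecMod.val` of sums -/

/-- The face `U_α = ⋂_k U_{α k}` of a tuple is the open `U_{ {α} }` of its set of values. [cite: GortzWedhorn2023, Def. 21.64 (p. 179)] -/
theorem face_eq_cechOpen_image {n : ℕ} (α : Fin (n + 1) → ι) : face U α = cechOpen U (Finset.univ.image α) := by
  refine le_antisymm (Finset.le_inf fun i hi => ?_) (le_iInf fun k => cechOpen_le U (Finset.mem_image_of_mem α (Finset.mem_univ k)))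
  obtain ⟨k, -, rfl⟩ := Finset.mem_image.1 hi
  exact face_le U α k

/-- `U_{ {α} } ≤ X ∩ U_α`. [cite: GortzWedhorn2023, Def. 21.64 (p. 179)] -/
theorem cechOpen_image_le_top_inf_face {n : ℕ} (α : Fin (n + 1) → ι) :
    cechOpen U (Finset.univ.image α) ≤ ⊤ ⊓ face U α := by
  rw [top_inf_eq, face_eq_cechOpen_image]

/-- `X ∩ U_α ≤ U_{ {α} }`. [cite: GortzWedhorn2023, Def. 21.64 (p. 179)] -/
theorem top_inf_face_le_cechOpen_image {n : ℕ} (α : Fin (n + 1) → ι) :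
    ⊤ ⊓ face U α ≤ cechOpen U (Finset.univ.image α) := by
  rw [top_inf_eq, face_eq_cechOpen_image]

variable {M ρ} in
/-- `SecMod.val` of an integer multiple. [folklore] -/
private theorem val_zsmul' {V : X.Opens} (k : ℤ) (x : SecMod M ρ V) :
    SecMod.val (L := M) (ρ := ρ) (k • x) = k • SecMod.val (L := M) (ρ := ρ) x :=
  map_zsmul (⟨⟨SecMod.val (L := M) (ρ := ρ), SecMod.val_zero⟩, SecMod.val_add⟩ : SecMod M ρ V →+ Γ(M, V)) k x

variable {M ρ} in
/-- `SecMod.val` of a finite sum. [folklore] -/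
private theorem val_sum' {V : X.Opens} {κ : Type*} (t : Finset κ) (f : κ → SecMod M ρ V) :
    SecMod.val (L := M) (ρ := ρ) (∑ k ∈ t, f k) = ∑ k ∈ t, SecMod.val (L := M) (ρ := ρ) (f k) :=
  map_sum (⟨⟨SecMod.val (L := M) (ρ := ρ), SecMod.val_zero⟩, SecMod.val_add⟩ : SecMod M ρ V →+ Γ(M, V)) f t

variable {M ρ} in
/-- Integer signs act on sections through the base ring. [folklore] -/
private theorem sign_smul_eq_sgn_smul' {V : X.Opens} (s : Finset ι) (a : ι) (x : SecMod M ρ V) :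
    (OrderedCech.sign A s a • x : SecMod M ρ V) = CechOrd.sgn s a • x := by
  unfold OrderedCech.sign CechOrd.sgn
  rw [← Int.cast_smul_eq_zsmul A, Int.cast_pow, Int.cast_neg, Int.cast_one]

/-! ## §1 The full side: `Π_α Γ(M, X ∩ U_α) ≃+ Full.Cochain S n` -/

namespace Cech

/-- **The full cochain dictionary** `Π_{α : [n] → ι} Γ(M, X ∩ U_α) ≃+ OrderedCech.Full.Cochain (sectionsSystem 𝓤 M ρ) n`:
restrict each component along `U_{ {α} } = X ∩ U_α`. [cite: GortzWedhorn2023, Def. 21.64 (p. 179)] [cite: StacksProject, Tag 01FG] -/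
def sectionsToCochain (n : ℕ) : Cech.Sections U n M ⊤ ≃+ OrderedCech.Full.Cochain (sectionsSystem U M ρ) n where
  toFun c α := SecMod.mk (ρ := ρ) (Cech.res M (cechOpen_image_le_top_inf_face U α) (c α))
  invFun g α := Cech.res M (top_inf_face_le_cechOpen_image U α) (SecMod.val (L := M) (ρ := ρ) (g α))
  left_inv c := by
    funext α
    change Cech.res M _ (Cech.res M _ (c α)) = c α
    rw [Cech.res_res, Cech.res_self]
  right_inv g := by
    funext α
    apply SecMod.val_injective (L := M) (ρ := ρ)
    change Cech.res M _ (Cech.res M _ (SecMod.val (L := M) (ρ := ρ) (g α))) = _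
    rw [Cech.res_res, Cech.res_self]
  map_add' c c' := by
    funext α
    apply SecMod.val_injective (L := M) (ρ := ρ)
    change Cech.res M _ ((c + c') α) = Cech.res M _ (c α) + Cech.res M _ (c' α)
    rw [Cech.add_apply, map_add]

/-- Components of the dictionary (underlying sections). [cite: GortzWedhorn2023, Def. 21.64 (p. 179)] -/
@[simp] theorem val_sectionsToCochain_apply (n : ℕ) (c : Cech.Sections U n M ⊤) (α : Fin (n + 1) → ι) :
    SecMod.val (L := M) (ρ := ρ) (sectionsToCochain U M ρ n c α) = Cech.res M (cechOpen_image_le_top_inf_face U α) (c α) := rfl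

/-- Components of the inverse dictionary. [cite: GortzWedhorn2023, Def. 21.64 (p. 179)] -/
@[simp] theorem sectionsToCochain_symm_apply (n : ℕ) (g : OrderedCech.Full.Cochain (sectionsSystem U M ρ) n)
    (α : Fin (n + 1) → ι) :
    (sectionsToCochain U M ρ n).symm g α = Cech.res M (top_inf_face_le_cechOpen_image U α) (SecMod.val (L := M) (ρ := ρ) (g α)) :=
  rfl

/-- **The full dictionary intertwines the differentials**: `e (d c) = d (e c)` for the sectionwise Čech differential
★ `Cech.dSections` and the differential of ★ `OrderedCech.Full.complex` (both are `Σ_j (-1)^j c_{α ∘ δ_j}|`).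
[cite: GortzWedhorn2023, Def. 21.64 (p. 179)] [cite: StacksProject, Tag 01FG] -/
theorem sectionsToCochain_dSections (n : ℕ) (c : Cech.Sections U n M ⊤) :
    sectionsToCochain U M ρ (n + 1) (Cech.dSections U M n ⊤ c) =
      ((OrderedCech.Full.complex (sectionsSystem U M ρ)).d n (n + 1)).hom (sectionsToCochain U M ρ n c) := by
  funext β
  apply SecMod.val_injective (L := M) (ρ := ρ)
  rw [val_sectionsToCochain_apply, OrderedCech.Full.complex_d_apply, val_sum']
  unfold Cech.dSections
  rw [map_sum]
  refine Finset.sum_congr rfl fun j _ => ?_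
  rw [map_zsmul, val_zsmul', Cech.res_res, sectionsSystem_map_apply, SecMod.val_res, val_sectionsToCochain_apply]
  congr 1
  exact (Cech.res_res (M := M) _ _ (c (β ∘ Fin.succAbove j))).symm

end Cech

/-! ## §2 The ordered side: `Π_s Γ(M, X ∩ U_s) ≃+ SysCochain S n` (explicit form of `exists_cechSectionsAddEquiv`) -/

namespace CechOrd

/-- The ordered sheaf index of an algebraic simplex. [cite: GortzWedhorn2023, Def. 21.68 (p. 180)] -/
def idxOfSimplex {m : ℕ} (σ : OrderedCech.Simplex ι (m : ℤ)) : CechOrd.Idx ι m :=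
  fun _ => ⟨σ.1, by have := σ.2.2; omega⟩

/-- The algebraic simplex of an ordered sheaf index. [cite: GortzWedhorn2023, Def. 21.68 (p. 180)] -/
def simplexOfIdx {m : ℕ} (β : CechOrd.Idx ι m) : OrderedCech.Simplex ι (m : ℤ) :=
  ⟨(β 0).1, Finset.card_pos.1 (by rw [(β 0).2]; omega), by rw [(β 0).2]; push_cast; ring⟩

/-- The underlying finite set of `idxOfSimplex σ` is `σ`. [cite: GortzWedhorn2023, Def. 21.68 (p. 180)] -/
@[simp] theorem idxOfSimplex_val {m : ℕ} (σ : OrderedCech.Simplex ι (m : ℤ)) (k : Fin 1) : (idxOfSimplex σ k).1 = σ.1 := rfl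

/-- The underlying finite set of `simplexOfIdx β` is `β 0`. [cite: GortzWedhorn2023, Def. 21.68 (p. 180)] -/
@[simp] theorem simplexOfIdx_val {m : ℕ} (β : CechOrd.Idx ι m) : (simplexOfIdx β).1 = (β 0).1 := rfl

/-- Round trip. [cite: GortzWedhorn2023, Def. 21.68 (p. 180)] -/
@[simp] theorem idxOfSimplex_simplexOfIdx {m : ℕ} (β : CechOrd.Idx ι m) : idxOfSimplex (simplexOfIdx β) = β :=
  CechOrd.Idx.ext rfl

/-- Round trip. [cite: GortzWedhorn2023, Def. 21.68 (p. 180)] -/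
@[simp] theorem simplexOfIdx_idxOfSimplex {m : ℕ} (σ : OrderedCech.Simplex ι (m : ℤ)) : simplexOfIdx (idxOfSimplex σ) = σ :=
  Subtype.ext rfl

/-- The forward map of the ordered dictionary (restriction along `U_s ⊆ X ∩ U_s`). [folklore]
[cite: GortzWedhorn2023, Def. 21.68 (p. 180)] -/
private def toC (m : ℕ) (c : Cech.Sections (CechOrd.faces U m) 0 M ⊤) : OrderedCech.SysCochain (sectionsSystem U M ρ) (m : ℤ) :=
  fun σ => SecMod.mk (ρ := ρ) (Cech.res M (le_top_inf_face U (idxOfSimplex σ)) (c (idxOfSimplex σ)))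

/-- The inverse map of the ordered dictionary (restriction along `X ∩ U_s ⊆ U_s`). [folklore]
[cite: GortzWedhorn2023, Def. 21.68 (p. 180)] -/
private def ofC (m : ℕ) (g : OrderedCech.SysCochain (sectionsSystem U M ρ) (m : ℤ)) : Cech.Sections (CechOrd.faces U m) 0 M ⊤ :=
  fun β => Cech.res M (top_inf_face_le U β) (SecMod.val (L := M) (ρ := ρ) (g (simplexOfIdx β)))

/-- Components of the forward map. [folklore] [cite: GortzWedhorn2023, Def. 21.68 (p. 180)] -/
private theorem val_toC (m : ℕ) (c : Cech.Sections (CechOrd.faces U m) 0 M ⊤) (σ : OrderedCech.Simplex ι (m : ℤ)) :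
    SecMod.val (L := M) (ρ := ρ) (toC U M ρ m c σ) = Cech.res M (le_top_inf_face U (idxOfSimplex σ)) (c (idxOfSimplex σ)) := rfl

/-- Components of the inverse map. [folklore] [cite: GortzWedhorn2023, Def. 21.68 (p. 180)] -/
private theorem ofC_apply (m : ℕ) (g : OrderedCech.SysCochain (sectionsSystem U M ρ) (m : ℤ)) (β : CechOrd.Idx ι m) :
    ofC U M ρ m g β = Cech.res M (top_inf_face_le U β) (SecMod.val (L := M) (ρ := ρ) (g (simplexOfIdx β))) := rfl

/-- **The ordered cochain dictionary** `Π_{#s = n+1} Γ(M, X ∩ U_s) ≃+ OrderedCech.SysCochain (sectionsSystem 𝓤 M ρ) n`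
(restriction along `X ∩ U_s = U_s`; the explicit form of ★ `exists_cechSectionsAddEquiv`).
[cite: GortzWedhorn2023, Def. 21.68 (p. 180)] -/
def sectionsToSysCochain (m : ℕ) :
    Cech.Sections (CechOrd.faces U m) 0 M ⊤ ≃+ OrderedCech.SysCochain (sectionsSystem U M ρ) (m : ℤ) where
  toFun := toC U M ρ m
  invFun := ofC U M ρ m
  left_inv c := by
    funext β
    rw [ofC_apply, val_toC]
    erw [Cech.res_res]
    rw [CechOrd.res_apply_congr U M c (idxOfSimplex_simplexOfIdx β) _ le_rfl, Cech.res_self]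
  right_inv g := by
    funext σ
    apply SecMod.val_injective (L := M) (ρ := ρ)
    rw [val_toC, ofC_apply]
    erw [Cech.res_res]
    rw [Cech.res_self]
    rfl
  map_add' c c' := by
    funext σ
    apply SecMod.val_injective (L := M) (ρ := ρ)
    change SecMod.val (L := M) (ρ := ρ) (toC U M ρ m (c + c') σ) =
      SecMod.val (L := M) (ρ := ρ) (toC U M ρ m c σ + toC U M ρ m c' σ)
    rw [SecMod.val_add, val_toC, val_toC, val_toC, Cech.add_apply, map_add]

/-- Components of the dictionary (underlying sections). [cite: GortzWedhorn2023, Def. 21.68 (p. 180)] -/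
@[simp] theorem val_sectionsToSysCochain_apply (m : ℕ) (c : Cech.Sections (CechOrd.faces U m) 0 M ⊤)
    (σ : OrderedCech.Simplex ι (m : ℤ)) :
    SecMod.val (L := M) (ρ := ρ) (sectionsToSysCochain U M ρ m c σ) =
      Cech.res M (le_top_inf_face U (idxOfSimplex σ)) (c (idxOfSimplex σ)) := rfl

/-- Components of the inverse dictionary. [cite: GortzWedhorn2023, Def. 21.68 (p. 180)] -/
@[simp] theorem sectionsToSysCochain_symm_apply (m : ℕ) (g : OrderedCech.SysCochain (sectionsSystem U M ρ) (m : ℤ))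
    (β : CechOrd.Idx ι m) :
    (sectionsToSysCochain U M ρ m).symm g β =
      Cech.res M (top_inf_face_le U β) (SecMod.val (L := M) (ρ := ρ) (g (simplexOfIdx β))) := rfl

variable [Fintype ι]

/-- **The ordered dictionary intertwines the differentials** `(d c)_t = Σ_{a ∈ t} ε(t, a) c_{t ∖ a}|` (★ `CechOrd.d`) and
★ `OrderedCech.sysD`. [cite: GortzWedhorn2023, Def. 21.68 (p. 180)] -/
theorem sectionsToSysCochain_d (n : ℕ) (c : Cech.Sections (CechOrd.faces U n) 0 M ⊤) :
    sectionsToSysCochain U M ρ (n + 1) ((CechOrd.d U M n).app ⊤ c) =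
      OrderedCech.sysD (sectionsSystem U M ρ) (n : ℤ) (sectionsToSysCochain U M ρ n c) := by
  funext σ
  apply SecMod.val_injective (L := M) (ρ := ρ)
  rw [val_sectionsToSysCochain_apply, CechOrd.d_app_apply_eq_sum_attach, OrderedCech.sysD_apply, map_sum, val_sum']
  conv_rhs => rw [← Finset.sum_attach]
  refine Finset.sum_congr rfl fun a _ => ?_
  rw [map_zsmul, sign_smul_eq_sgn_smul', val_zsmul', Cech.res_res]
  congr 1
  have hmem : (a : ι) ∈ σ.1 := a.2
  have hcardN : (σ.1.erase a).card = n + 1 := by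
    have h1 : (σ.1.erase a).card = σ.1.card - 1 := Finset.card_erase_of_mem hmem
    have h2 : σ.1.card = n + 2 := by have := σ.2.2; omega
    omega
  have hcard : ((σ.1.erase a).card : ℤ) = n + 1 := by rw [hcardN]; push_cast; ring
  have hne : (σ.1.erase a).Nonempty := Finset.card_pos.1 (by omega)
  let τ : OrderedCech.Simplex ι (n : ℤ) := ⟨σ.1.erase a, hne, hcard⟩
  change _ = SecMod.val (L := M) (ρ := ρ) ((sectionsToSysCochain U M ρ n c).ext0At τ.1 σ.1)
  rw [OrderedCech.SysCochain.ext0At_val _ τ σ.1 (Finset.erase_subset _ _), sectionsSystem_map_apply,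
    SecMod.val_res, val_sectionsToSysCochain_apply]
  change _ = Cech.res M _ (Cech.res M _ (c (idxOfSimplex τ)))
  rw [Cech.res_res]
  rfl

omit [Fintype ι] in
/-- **The ordered dictionary carries `ρ(a) • _` to `a • _`.** [cite: GortzWedhorn2023, Def. 21.68 (p. 180)] -/
theorem sectionsToSysCochain_smul (n : ℕ) (a : A) (c : Cech.Sections (CechOrd.faces U n) 0 M ⊤) :
    sectionsToSysCochain U M ρ n (ρ a • c) = a • sectionsToSysCochain U M ρ n c := by
  funext σ
  apply SecMod.val_injective (L := M) (ρ := ρ)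
  change SecMod.val (L := M) (ρ := ρ) (sectionsToSysCochain U M ρ n (ρ a • c) σ) =
    SecMod.val (L := M) (ρ := ρ) (a • sectionsToSysCochain U M ρ n c σ)
  rw [val_sectionsToSysCochain_apply, SecMod.smul_def, val_sectionsToSysCochain_apply, Cech.smul_apply, Scheme.Modules.map_smul]
  congr 1
  change (X.presheaf.map (homOfLE _).op ≫ X.presheaf.map (homOfLE _).op) (ρ a) = X.presheaf.map (homOfLE _).op (ρ a)
  rw [← Functor.map_comp, ← op_comp]
  rfl

/-! ## §3 The dictionaries carry `resOfFullObj` to `Full.res` -/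

omit [Fintype ι] in
/-- **Under the two dictionaries the sheaf-level restriction `res : Čⁿ(𝓤, M) → Čⁿ_ord(𝓤, M)` (★ `CechOrd.resOfFullObj`) is the
algebraic restriction ★ `OrderedCech.Full.res`** (both keep the component at the sorted enumeration of each simplex).
[cite: StacksProject, Tag 01FG] [cite: GortzWedhorn2023, Def. 21.68 (p. 180)] -/
theorem sectionsToSysCochain_resOfFullObj (n : ℕ) (c : Cech.Sections U n M ⊤) :
    sectionsToSysCochain U M ρ n ((resOfFullObj U M n).app ⊤ c) =
      OrderedCech.Full.res (sectionsSystem U M ρ) n (Cech.sectionsToCochain U M ρ n c) := by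
  funext σ
  apply SecMod.val_injective (L := M) (ρ := ρ)
  rw [val_sectionsToSysCochain_apply, resOfFullObj_app_apply, Cech.res_res, OrderedCech.Full.res_apply,
    sectionsSystem_map_apply, SecMod.val_res, Cech.val_sectionsToCochain_apply]
  change _ = Cech.res M _ (Cech.res M _ (c _))
  rw [Cech.res_res]
  rfl

/-! ## §4 HOWTO (b), algebraic currency -/

/-- **A cocycle of the full algebraic Čech complex of `S = (Γ(M, U_s))_s` whose restriction to increasing tuples is an ordered
coboundary is a coboundary**: for a finite cover `𝓤` of the scheme `X` all of whose nonempty finite intersections `U_s` are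
affine and an affine-localizing (e.g. quasi-coherent) `𝒪_X`-module `M`, if `c ∈ Full.Cochain S (n+1)` satisfies `d c = 0` and
`Full.res c = sysD g` then `c = d w` for some `w ∈ Full.Cochain S n`.  (★ `CechOrd.exists_dSections_eq_of_resOfFull_eq_d` — the
injectivity of `H(res)`, Leray on both sides — transported through the dictionaries of §1–§3.)
[cite: StacksProject, Tag 01FM] [cite: GortzWedhorn2023, Thm. 22.9 (p. 236)] -/
theorem _root_.Literature.Algebra.Homology.OrderedCech.Full.exists_d_eq_of_res_eq_sysD
    (hUa : ∀ s : Finset ι, s.Nonempty → IsAffineOpen (cechOpen U s)) (hcov : ⨆ i, U i = ⊤) (hM : IsAffineLocalizing M)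
    (n : ℕ) (c : OrderedCech.Full.Cochain (sectionsSystem U M ρ) (n + 1))
    (hc : ((OrderedCech.Full.complex (sectionsSystem U M ρ)).d (n + 1) (n + 2)).hom c = 0)
    (g : OrderedCech.SysCochain (sectionsSystem U M ρ) (n : ℤ))
    (hg : OrderedCech.Full.res (sectionsSystem U M ρ) (n + 1) c = OrderedCech.sysD (sectionsSystem U M ρ) (n : ℤ) g) :
    ∃ w : OrderedCech.Full.Cochain (sectionsSystem U M ρ) n,
      ((OrderedCech.Full.complex (sectionsSystem U M ρ)).d n (n + 1)).hom w = c := by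
  letI := HasExt.standard X.Modules
  -- the affine faces in the two spellings
  have hU : ∀ {m : ℕ} (β : Fin (m + 1) → ι), IsAffineOpen (face U β) := fun β => by
    rw [face_eq_cechOpen_image]
    exact hUa _ ⟨β 0, Finset.mem_image_of_mem β (Finset.mem_univ 0)⟩
  have hU' : ∀ s : Finset ι, s.Nonempty → IsAffineOpen (faceSet U s) := fun s hs => by
    rw [faceSet_eq_cechOpen]; exact hUa s hs
  -- transport `c` and `g` to the sheaf side
  set c' : Cech.Sections U (n + 1) M ⊤ := (Cech.sectionsToCochain U M ρ (n + 1)).symm c with hc'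
  set g' : Cech.Sections (faces U n) 0 M ⊤ := (sectionsToSysCochain U M ρ n).symm g with hg'
  have hcc : Cech.sectionsToCochain U M ρ (n + 1) c' = c := AddEquiv.apply_symm_apply _ c
  have hgg : sectionsToSysCochain U M ρ n g' = g := AddEquiv.apply_symm_apply _ g
  have hdc' : Cech.dSections U M (n + 1) ⊤ c' = 0 := by
    apply (Cech.sectionsToCochain U M ρ (n + 2)).injective
    rw [Cech.sectionsToCochain_dSections, hcc, hc, map_zero]
  have hres : ((resOfFullObj U M (n + 1)).app ⊤ c' : Cech.Sections (faces U (n + 1)) 0 M ⊤) = (d U M n).app ⊤ g' := by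
    apply (sectionsToSysCochain U M ρ (n + 1)).injective
    rw [sectionsToSysCochain_resOfFullObj, hcc, hg, sectionsToSysCochain_d, hgg]
  obtain ⟨w', hw'⟩ := exists_dSections_eq_of_resOfFull_eq_d U M hU hU' hcov hM n c' hdc' g' hres
  refine ⟨Cech.sectionsToCochain U M ρ n w', ?_⟩
  rw [← Cech.sectionsToCochain_dSections, hw', hcc]

end CechOrd

end Literature.AlgebraicGeometry.Modules

end
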